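/-
Copyright: H21 programme, solo seat `solo-RiemannHypothesis-informed` (session 4).
-/
import Summits.RiemannHypothesis.RiemannHypothesis.Theorems.SoloInformedDensityConst
import Literature.NumberTheory.LFunctions.VinogradovKorobovInputs
import Literature.NumberTheory.LFunctions.ZetaZerosProofs
import Mathlib.Analysis.Complex.ExponentialBounds
import Mathlib.MeasureTheory.Measure.Lebesgue.Integral

/-!
# An explicit bound for the density constant (solo-informed, T22)

Second step of the effectivity programme (T21 defined `zetaDensityConst`, the least `A` with
`∑_n 1/(1+(t−γ_n)²) ≤ A log(|t|+2)` for all `t`). Here: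

* `sum_density_le_of_local_count` — the window argument of `Montgomery.exists_density_le` with the
  local zero-count constant `A` (`N(a+1) − N(a) ≤ A log(a+2)`, `a ≥ 0`) kept as a PARAMETER:
  `∑_{n∈S} 1/(1+(t−γ_n)²) ≤ 144·A·(2^{7/4}·J)·log(|t|+2)`, `J = ∫ (1+|v|)^{-7/4} dv`;
* `integral_one_add_abs_rpow : J = 8/3`;
* `zetaDensityConst_le_of_local_count : zetaDensityConst ≤ 144·A·(2^{7/4}·8/3)`;
* `zetaZeroCount_add_one_sub_le_of_hsw` — from the NAMED FACT
  `zetaZeroCount_hasanalizade_shen_wong` (`|N(T) − (T/2π)log(T/2πe)| ≤ 0.1038 log T +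
  0.2573 log log T + 9.3675`, `T ≥ e`): `N(a+1) − N(a) ≤ 20 log(a+2)` for every `a ≥ 0`;
* `zetaDensityConst_le_of_hsw : zetaDensityConst ≤ 27000` under that named fact.

So every constant of T9a–T20 phrased through `zetaDensityConst` is bounded by an absolute number,
conditionally on one published explicit zero-counting theorem (taken as a hypothesis, D-0014).
-/

open Real Set Filter MeasureTheory Topology Literature.NumberTheory.LFunctions
open Literature.NumberTheory.LFunctions.Montgomery

namespace Summit.RiemannHypothesis.RiemannHypothesis.Theorems

/-- **Parametrised density bound** (the window argument of `Montgomery.exists_density_le` with the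
local-count constant as a parameter): if `N(a+1) − N(a) ≤ A log(a+2)` for all `a ≥ 0` then every
finite partial sum satisfies `∑_{n∈S} 1/(1+(t−γ_n)²) ≤ 144·A·(2^{7/4}·∫(1+|v|)^{-7/4})·log(|t|+2)`. -/
theorem sum_density_le_of_local_count {A : ℝ} (hA0 : 0 < A)
    (hA : ∀ a : ℝ, 0 ≤ a → (zetaZeroCount (a + 1) : ℝ) - zetaZeroCount a ≤ A * Real.log (a + 2))
    (t : ℝ) (S : Finset ℕ) :
    ∑ n ∈ S, 1 / (1 + (t - zetaOrdinate n) ^ 2) ≤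
      144 * A * (2 ^ (7 / 4 : ℝ) * ∫ v : ℝ, (1 + ‖v‖) ^ (-(7 / 4 : ℝ))) * Real.log (|t| + 2) := by
  set J : ℝ := ∫ v : ℝ, (1 + ‖v‖) ^ (-(7 / 4 : ℝ)) with hJ
  have hJint : Integrable fun v : ℝ ↦ (1 + ‖v‖) ^ (-(7 / 4 : ℝ)) :=
    integrable_one_add_norm (by rw [Module.finrank_self]; norm_num)
  have hlog0 : 0 ≤ Real.log (|t| + 2) := Real.log_nonneg (by linarith [abs_nonneg t])
  set W : Finset ℕ := S.image fun n ↦ ⌈zetaOrdinate n⌉₊ - 1 with hWdef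
  have hW : ∀ n ∈ S, ⌈zetaOrdinate n⌉₊ - 1 ∈ W := fun n hn ↦ Finset.mem_image_of_mem _ hn
  have step1 := sum_le_sum_windows_log hA S W hW (fun n ↦ 1 / (1 + (t - zetaOrdinate n) ^ 2))
    (fun m ↦ 8 / (4 + (t - m) ^ 2)) (fun m _ ↦ by positivity) fun n _ ↦
      one_div_one_add_sq_le_window (window_spec n).1 (window_spec n).2
  have step2 : ∀ m ∈ W, A * Real.log ((m : ℝ) + 2) * (8 / (4 + (t - m) ^ 2)) ≤
      144 * A * Real.log (|t| + 2) * (1 + |(m : ℝ) - t|) ^ (-(7 / 4 : ℝ)) := by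
    intro m _
    have hm0 : (0 : ℝ) ≤ m := Nat.cast_nonneg m
    have h1 := log_add_two_le' t hm0
    have h2 := eight_div_le (t - m)
    rw [abs_sub_comm] at h2
    have hb : 0 < 1 + |(m : ℝ) - t| := by positivity
    have hr0 : 0 ≤ (1 + |(m : ℝ) - t|) ^ (1 / 4 : ℝ) := by positivity
    have e : (1 + |(m : ℝ) - t|) ^ (-(7 / 4 : ℝ)) =
        (1 + |(m : ℝ) - t|) ^ (1 / 4 : ℝ) / (1 + |(m : ℝ) - t|) ^ 2 := by
      rw [eq_div_iff (by positivity), ← Real.rpow_natCast, ← Real.rpow_add hb]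
      norm_num
    rw [e]
    calc A * Real.log ((m : ℝ) + 2) * (8 / (4 + (t - m) ^ 2))
        ≤ A * (9 * Real.log (|t| + 2) * (1 + |(m : ℝ) - t|) ^ (1 / 4 : ℝ)) *
            (8 / (4 + (t - m) ^ 2)) :=
          mul_le_mul_of_nonneg_right (mul_le_mul_of_nonneg_left h1 hA0.le) (by positivity)
      _ ≤ A * (9 * Real.log (|t| + 2) * (1 + |(m : ℝ) - t|) ^ (1 / 4 : ℝ)) *
            (16 / (1 + |(m : ℝ) - t|) ^ 2) :=
          mul_le_mul_of_nonneg_left h2 (mul_nonneg hA0.le (by positivity))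
      _ = 144 * A * Real.log (|t| + 2) *
            ((1 + |(m : ℝ) - t|) ^ (1 / 4 : ℝ) / (1 + |(m : ℝ) - t|) ^ 2) := by ring
  have step3 : ∑ m ∈ W, (1 + |(m : ℝ) - t|) ^ (-(7 / 4 : ℝ)) ≤ 2 ^ (7 / 4 : ℝ) * J := by
    have hint : Integrable fun u : ℝ ↦ 2 ^ (7 / 4 : ℝ) * (1 + ‖u - t‖) ^ (-(7 / 4 : ℝ)) :=
      (hJint.comp_sub_right t).const_mul _
    calc ∑ m ∈ W, (1 + |(m : ℝ) - t|) ^ (-(7 / 4 : ℝ))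
        ≤ ∫ u in Set.univ, 2 ^ (7 / 4 : ℝ) * (1 + ‖u - t‖) ^ (-(7 / 4 : ℝ)) := by
          refine sum_le_setIntegral_of_le_on_cells W _ MeasurableSet.univ
            (fun _ _ ↦ subset_univ _) hint.integrableOn (fun u _ ↦ by positivity)
            fun m _ u hu1 hu2 ↦ ?_
          rw [Real.norm_eq_abs]
          have hb : 0 < (1 + |u - t|) / 2 := by positivity
          have hle : (1 + |u - t|) / 2 ≤ 1 + |(m : ℝ) - t| := by
            have := abs_sub_le u m t
            have : |u - (m : ℝ)| ≤ 1 := by rw [abs_le]; constructor <;> linarith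
            linarith [abs_nonneg ((m : ℝ) - t)]
          calc (1 + |(m : ℝ) - t|) ^ (-(7 / 4 : ℝ)) ≤ ((1 + |u - t|) / 2) ^ (-(7 / 4 : ℝ)) :=
                Real.rpow_le_rpow_of_nonpos hb hle (by norm_num)
            _ = 2 ^ (7 / 4 : ℝ) * (1 + |u - t|) ^ (-(7 / 4 : ℝ)) := by
                rw [Real.div_rpow (by positivity) (by norm_num),
                  Real.rpow_neg (by norm_num : (0 : ℝ) ≤ 2), div_inv_eq_mul, mul_comm]
      _ = 2 ^ (7 / 4 : ℝ) * J := by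
          rw [setIntegral_univ, MeasureTheory.integral_const_mul]
          congr 1
          exact integral_sub_right_eq_self (fun v : ℝ ↦ (1 + ‖v‖) ^ (-(7 / 4 : ℝ))) t
  calc ∑ n ∈ S, 1 / (1 + (t - zetaOrdinate n) ^ 2)
      ≤ ∑ m ∈ W, A * Real.log ((m : ℝ) + 2) * (8 / (4 + (t - m) ^ 2)) := step1
    _ ≤ ∑ m ∈ W, 144 * A * Real.log (|t| + 2) * (1 + |(m : ℝ) - t|) ^ (-(7 / 4 : ℝ)) :=
        Finset.sum_le_sum step2
    _ = 144 * A * Real.log (|t| + 2) * ∑ m ∈ W, (1 + |(m : ℝ) - t|) ^ (-(7 / 4 : ℝ)) := by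
        rw [Finset.mul_sum]
    _ ≤ 144 * A * Real.log (|t| + 2) * (2 ^ (7 / 4 : ℝ) * J) :=
        mul_le_mul_of_nonneg_left step3 (by positivity)
    _ = 144 * A * (2 ^ (7 / 4 : ℝ) * J) * Real.log (|t| + 2) := by ring

/-- `∫_ℝ (1+|v|)^{-7/4} dv = 8/3`. -/
theorem integral_one_add_abs_rpow : ∫ v : ℝ, (1 + ‖v‖) ^ (-(7 / 4 : ℝ)) = 8 / 3 := by
  have h1 : (fun v : ℝ ↦ (1 + ‖v‖) ^ (-(7 / 4 : ℝ))) =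
      fun v ↦ (fun u : ℝ ↦ (1 + u) ^ (-(7 / 4 : ℝ))) |v| := by
    funext v; simp [Real.norm_eq_abs]
  rw [h1, integral_comp_abs (f := fun u : ℝ ↦ (1 + u) ^ (-(7 / 4 : ℝ)))]
  -- the half-line integral by the improper fundamental theorem of calculus
  have hJint : Integrable fun v : ℝ ↦ (1 + ‖v‖) ^ (-(7 / 4 : ℝ)) :=
    integrable_one_add_norm (by rw [Module.finrank_self]; norm_num)
  have hint : IntegrableOn (fun u : ℝ ↦ (1 + u) ^ (-(7 / 4 : ℝ))) (Ioi 0) :=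
    hJint.integrableOn.congr_fun (fun u hu ↦ by
      simp [Real.norm_eq_abs, abs_of_pos (mem_Ioi.1 hu)]) measurableSet_Ioi
  have hderiv : ∀ u ∈ Ioi (0 : ℝ),
      HasDerivAt (fun u : ℝ ↦ -(4 / 3) * (1 + u) ^ (-(3 / 4 : ℝ))) ((1 + u) ^ (-(7 / 4 : ℝ))) u := by
    intro u hu
    have hu0 : 0 < 1 + u := by linarith [mem_Ioi.1 hu]
    have h := (((hasDerivAt_id u).const_add 1).rpow_const (p := -(3 / 4 : ℝ))
      (Or.inl hu0.ne')).const_mul (-(4 / 3) : ℝ)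
    refine h.congr_deriv ?_
    rw [show (-(3 / 4 : ℝ) - 1) = -(7 / 4 : ℝ) by norm_num]
    simp only [id]
    ring
  have hcont : ContinuousWithinAt (fun u : ℝ ↦ -(4 / 3) * (1 + u) ^ (-(3 / 4 : ℝ))) (Ici 0) 0 := by
    refine (continuousAt_const.mul ?_).continuousWithinAt
    exact ((continuous_const.add continuous_id).continuousAt).rpow_const (Or.inl (by norm_num))
  have hlim : Tendsto (fun u : ℝ ↦ -(4 / 3) * (1 + u) ^ (-(3 / 4 : ℝ))) atTop (𝓝 (-(4 / 3) * 0)) := by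
    refine Tendsto.const_mul _ ?_
    have h := tendsto_rpow_neg_atTop (by norm_num : (0 : ℝ) < 3 / 4)
    exact h.comp (tendsto_atTop_add_const_left atTop 1 tendsto_id)
  rw [integral_Ioi_of_hasDerivAt_of_tendsto hcont hderiv hint hlim]
  norm_num

/-- **Density constant from a local count**: `zetaDensityConst ≤ 144·A·(2^{7/4}·8/3)` whenever
`N(a+1) − N(a) ≤ A log(a+2)` for all `a ≥ 0`. -/
theorem zetaDensityConst_le_of_local_count {A : ℝ} (hA0 : 0 < A)
    (hA : ∀ a : ℝ, 0 ≤ a → (zetaZeroCount (a + 1) : ℝ) - zetaZeroCount a ≤ A * Real.log (a + 2)) :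
    zetaDensityConst ≤ 144 * A * (2 ^ (7 / 4 : ℝ) * (8 / 3)) := by
  refine zetaDensityConst_le (mem_zetaDensitySet (by positivity) fun t ↦ ?_)
  have hnn : ∀ n : ℕ, 0 ≤ 1 / (1 + (t - zetaOrdinate n) ^ 2) := fun n ↦ by positivity
  have key := sum_density_le_of_local_count hA0 hA t
  rw [integral_one_add_abs_rpow] at key
  exact Real.tsum_le_of_sum_le hnn key

/-- **Explicit local zero count** from the named fact `zetaZeroCount_hasanalizade_shen_wong`
(`|N(T) − (T/2π) log(T/(2πe))| ≤ 0.1038 log T + 0.2573 log log T + 9.3675` for `T ≥ e`):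
`N(a+1) − N(a) ≤ 20 log(a+2)` for every `a ≥ 0`. (For `a ≥ e`: the main terms differ by
`≤ log(a+1)/(2π)` and each error term is `≤ 0.3611 log(a+2) + 9.3675 ≤ 9.73 log(a+2)`; for
`0 ≤ a < e`: `N(a+1) ≤ N(e+1) ≤ 10 ≤ 20 log 2`.) -/
theorem zetaZeroCount_add_one_sub_le_of_hsw (h : zetaZeroCount_hasanalizade_shen_wong)
    {a : ℝ} (ha : 0 ≤ a) :
    (zetaZeroCount (a + 1) : ℝ) - zetaZeroCount a ≤ 20 * Real.log (a + 2) := by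
  have hπ3 : 3 < π := Real.pi_gt_three
  have he1 : Real.exp 1 < 2.7182818286 := Real.exp_one_lt_d9
  have he0 : 2.7182818283 < Real.exp 1 := Real.exp_one_gt_d9
  have hl2 : 0.6931471803 < Real.log 2 := Real.log_two_gt_d9
  have hlog2 : Real.log 2 ≤ Real.log (a + 2) := Real.log_le_log (by norm_num) (by linarith)
  -- the error term of the named fact at any `T ≥ e` is at most `0.3611 (log T) + 9.3675 - 0.2573`
  have hE : ∀ T : ℝ, Real.exp 1 ≤ T →
      0.1038 * Real.log T + 0.2573 * Real.log (Real.log T) + 9.3675 ≤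
        0.3611 * Real.log T + 9.1102 := by
    intro T hT
    have hT1 : 1 ≤ Real.log T := by
      rw [Real.le_log_iff_exp_le (by linarith)]; exact hT
    have := Real.log_le_sub_one_of_pos (by linarith : 0 < Real.log T)
    linarith
  rcases le_or_gt (Real.exp 1) a with hae | hae
  · -- large `a`
    have ha0 : 0 < a := lt_of_lt_of_le (Real.exp_pos 1) hae
    have h1 := (abs_le.1 (h (a + 1) (by linarith))).2
    have h2 := (abs_le.1 (h a hae)).1
    have hE1 := hE (a + 1) (by linarith)
    have hE2 := hE a hae
    have hla2 : 1 ≤ Real.log (a + 2) := by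
      rw [Real.le_log_iff_exp_le (by linarith)]; linarith
    have hla1 : Real.log (a + 1) ≤ Real.log (a + 2) := Real.log_le_log (by linarith) (by linarith)
    have hla : Real.log a ≤ Real.log (a + 2) := Real.log_le_log ha0 (by linarith)
    have hla10 : 0 ≤ Real.log (a + 1) := Real.log_nonneg (by linarith)
    -- main terms
    have hc0 : 0 < 2 * π * Real.exp 1 := by positivity
    have hLc : 1 ≤ Real.log (2 * π * Real.exp 1) := by
      rw [Real.log_mul (by positivity) (Real.exp_pos 1).ne', Real.log_exp]
      have : 0 ≤ Real.log (2 * π) := Real.log_nonneg (by linarith)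
      linarith
    have hdiff : a * (Real.log (a + 1) - Real.log a) ≤ 1 := by
      rw [← Real.log_div (by linarith) ha0.ne']
      have hq := Real.log_le_sub_one_of_pos (by positivity : 0 < (a + 1) / a)
      have e : a * ((a + 1) / a - 1) = 1 := by field_simp; ring
      calc a * Real.log ((a + 1) / a) ≤ a * ((a + 1) / a - 1) :=
            mul_le_mul_of_nonneg_left hq ha0.le
        _ = 1 := e
    have hM : (a + 1) / (2 * π) * Real.log ((a + 1) / (2 * π * Real.exp 1)) -
        a / (2 * π) * Real.log (a / (2 * π * Real.exp 1)) ≤ Real.log (a + 2) / 6 := by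
      rw [Real.log_div (by linarith) hc0.ne', Real.log_div ha0.ne' hc0.ne']
      have e : (a + 1) / (2 * π) * (Real.log (a + 1) - Real.log (2 * π * Real.exp 1)) -
          a / (2 * π) * (Real.log a - Real.log (2 * π * Real.exp 1)) =
          (Real.log (a + 1) + a * (Real.log (a + 1) - Real.log a) -
            Real.log (2 * π * Real.exp 1)) / (2 * π) := by
        field_simp
        ring
      rw [e, div_le_div_iff₀ (by positivity) (by norm_num)]
      have hp : 0 ≤ (π - 3) * Real.log (a + 2) := mul_nonneg (by linarith) (by linarith)
      nlinarith [hp]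
    linarith
  · -- small `a`: `N(a+1) ≤ N(e+1) ≤ 10`
    have hmono : (zetaZeroCount (a + 1) : ℝ) ≤ zetaZeroCount (Real.exp 1 + 1) := by
      exact_mod_cast zetaZeroCount_mono (by linarith)
    have hN0 : (0 : ℝ) ≤ zetaZeroCount a := Nat.cast_nonneg _
    have h1 := (abs_le.1 (h (Real.exp 1 + 1) (by linarith))).2
    have hE1 := hE (Real.exp 1 + 1) (by linarith)
    have hc0 : 0 < 2 * π * Real.exp 1 := by positivity
    -- the main term at `e + 1` is nonpositive
    have hMle : (Real.exp 1 + 1) / (2 * π) * Real.log ((Real.exp 1 + 1) / (2 * π * Real.exp 1))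
        ≤ 0 := by
      have hlt : Real.log ((Real.exp 1 + 1) / (2 * π * Real.exp 1)) ≤ 0 := by
        apply Real.log_nonpos (by positivity)
        rw [div_le_one hc0]
        nlinarith
      exact mul_nonpos_of_nonneg_of_nonpos (by positivity) hlt
    -- `log(e+1) ≤ log 4 = 2 log 2 ≤ 1.3863`
    have hl4 : Real.log (Real.exp 1 + 1) ≤ 1.3863 := by
      have hlt2 : Real.log 2 < 0.6931471808 := Real.log_two_lt_d9
      have : Real.log (Real.exp 1 + 1) ≤ Real.log 4 := Real.log_le_log (by positivity) (by linarith)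
      have h4 : Real.log 4 = 2 * Real.log 2 := by
        rw [show (4 : ℝ) = 2 ^ 2 by norm_num, Real.log_pow]; norm_num
      linarith
    linarith

/-- **Explicit density constant** under the named fact `zetaZeroCount_hasanalizade_shen_wong`:
`zetaDensityConst ≤ 144·20·(2^{7/4}·8/3) ≤ 27000`. -/
theorem zetaDensityConst_le_of_hsw (h : zetaZeroCount_hasanalizade_shen_wong) :
    zetaDensityConst ≤ 27000 := by
  have h1 := zetaDensityConst_le_of_local_count (by norm_num : (0 : ℝ) < 20)
    (fun a ha ↦ zetaZeroCount_add_one_sub_le_of_hsw h ha)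
  -- `2^{7/4} ≤ 7/2` since `(2^{7/4})^4 = 128 ≤ (7/2)^4`
  have h2 : (2 : ℝ) ^ (7 / 4 : ℝ) ≤ 7 / 2 := by
    have hz : 0 ≤ (2 : ℝ) ^ (7 / 4 : ℝ) := by positivity
    have hz4 : ((2 : ℝ) ^ (7 / 4 : ℝ)) ^ (4 : ℕ) = 128 := by
      rw [← Real.rpow_mul_natCast (by norm_num : (0 : ℝ) ≤ 2)]
      rw [show (7 / 4 : ℝ) * ((4 : ℕ) : ℝ) = ((7 : ℕ) : ℝ) by norm_num, Real.rpow_natCast]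
      norm_num
    by_contra hlt
    push Not at hlt
    have : (7 / 2 : ℝ) ^ (4 : ℕ) < ((2 : ℝ) ^ (7 / 4 : ℝ)) ^ (4 : ℕ) :=
      pow_lt_pow_left₀ hlt (by norm_num) (by norm_num)
    rw [hz4] at this
    norm_num at this
  nlinarith [h2]

end Summit.RiemannHypothesis.RiemannHypothesis.Theorems
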